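import Summits.AnomalousDissipation.AnomalousDissipation.Theorems.SawtoothPulseCascadeConstructionRegular58
import Literature.Analysis.FluidPDE.ShearStageTransport

/-!
# The planar force `∂ₜū` of the sawtooth pulse cascade is mean-zero, divergence free and smooth at every time

Route `AnomalousDissipation/SawtoothPulseCascade`, crux K3loc (stmt-AnomalousDissipation-19492), registered line
`DriftFree`: force-side hygiene for stub S1(b) `stub_existence` (the lead's `existence_of_windows` reduces it to
closed-window classical planar Navier–Stokes existence for the force `planarForce P`; the tree's / the coming
forced local-existence theorems want a smooth, divergence-free, MEAN-ZERO force).  For the explicit cascade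
(`0 < δ₀`, `0 < d`; no hypothesis on `N₀`, `ρN`):

* `Cascade.tri_neg`, `Cascade.gaussKernel_neg`, `Cascade.roundedSaw_neg`, `Cascade.U_neg` — the triangle wave is
  odd and the Gaussian even, so the rounded sawtooth `S_δ` and every profile `U_j` are ODD;
  `Cascade.intervalIntegral_U_eq_zero` — `∫₀¹ U_j = 0` (odd and `1`-periodic);
* `Cascade.planarForce_eq_drift_of_mem_H` / `_of_mem_V` — on the closed half-slots of phase `j` the planar force
  is the 2D shear drift `ShearStage.drift 0 1 ⟨U_j⟩ (rateH_j′ t)` / `drift 1 0 ⟨U_j⟩ (rateV_j′ t)` (the `𝕋²` twin of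
  `Cascade.liftedForce_of_mem_H/V`); `Cascade.planarForce_of_neg` — it vanishes for `t < 0` (one-sided derivative
  within `[0,1)` at a point outside its closure);
* for EVERY `t : ℝ`: `Cascade.hasZeroMean_planarForce` (`∫_{𝕋²} ∂ₜū(t) = 0`, by `ShearStage.hasZeroMean_drift`),
  `Cascade.isDivFree_planarForce` (`ShearStage.isDivFree_drift`), `Cascade.isSmooth_planarForce`.

No new definitions, no named facts.
-/

-- `Summit.<Summit>.<Problem>` is the tree's mandated summit-side namespace (CONVENTIONS §2); for this
-- single-conjunct summit the two coincide, so the duplicate is deliberate (lakefile: off for `Summits`).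
set_option linter.dupNamespace false

noncomputable section

open MeasureTheory Set Filter Topology
open scoped NNReal ENNReal ContDiff
open Literature.Analysis Literature.Analysis.FunctionSpaces Literature.Analysis.FluidPDE
open Literature.Analysis.FluidPDE.SawtoothCascade
open Literature.Analysis.FluidPDE.SawtoothCascade.DriftFree

namespace Summit.AnomalousDissipation.AnomalousDissipation.Theorems

namespace Cascade

open CascadeParams

variable (P : CascadeParams)

/-! ## Parity: the profiles are odd, hence mean-zero over a period -/

/-- The triangle wave `tri = arcsin ∘ sin` is odd. -/
theorem tri_neg (θ : ℝ) : tri (-θ) = -tri θ := by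
  simp [tri, Real.sin_neg, Real.arcsin_neg]

/-- The Gaussian kernel is even. -/
theorem gaussKernel_neg (δ y : ℝ) : gaussKernel δ (-y) = gaussKernel δ y := by
  simp [gaussKernel]

/-- The rounded sawtooth `S_δ = tri ⋆ gaussKernel δ` is odd. -/
theorem roundedSaw_neg (δ θ : ℝ) : roundedSaw δ (-θ) = -roundedSaw δ θ := by
  unfold roundedSaw
  rw [← integral_neg, ← integral_neg_eq_self]
  refine integral_congr_ae (ae_of_all _ fun y => ?_)
  dsimp only
  rw [show -θ - -y = -(θ - y) by ring, tri_neg, gaussKernel_neg]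
  ring

/-- Every profile `U_j` is odd. -/
theorem U_neg (j : ℕ) (y : ℝ) : P.U j (-y) = -P.U j y := by
  unfold CascadeParams.U
  rw [show 2 * Real.pi * (P.N j : ℝ) * -y = -(2 * Real.pi * P.N j * y) by ring, roundedSaw_neg, neg_div]

/-- **`∫₀¹ U_j = 0`**: `U_j` is odd and `1`-periodic. -/
theorem intervalIntegral_U_eq_zero {j : ℕ} (hδ : 0 < P.δ j) : ∫ s in (0 : ℝ)..1, P.U j s = 0 := by
  have hc : Continuous (P.U j) := (P.lipschitzWith_U hδ).continuous
  have h1 : ∫ s in (0 : ℝ)..1, P.U j s = ∫ s in (-(1 / 2) : ℝ)..(1 / 2), P.U j s := by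
    have h := (P.U_periodic j).intervalIntegral_add_eq 0 (-(1 / 2))
    norm_num at h
    exact h
  have hodd : ∫ s in (-(1 / 2) : ℝ)..0, P.U j s = -∫ s in (0 : ℝ)..(1 / 2), P.U j s := by
    have h := intervalIntegral.integral_comp_neg (a := 0) (b := 1 / 2) (f := P.U j)
    rw [neg_zero] at h
    rw [← h]
    simp only [U_neg, intervalIntegral.integral_neg]
  rw [h1, ← intervalIntegral.integral_add_adjacent_intervals (hc.intervalIntegrable _ _)
    (hc.intervalIntegrable _ _) (b := 0), hodd]
  ring

/-! ## The planar force as a 2D shear drift on each half-slot; negative times -/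

/-- On the H half-slot of phase `j`, `∂ₜū(t) = rateH_j′(t) U_j(x₂) e₀` is the 2D shear drift
`ShearStage.drift 0 1 ⟨U_j⟩ (rateH_j′ t)`. -/
theorem planarForce_eq_drift_of_mem_H {j : ℕ} (hδ : 0 < P.δ j) {t : ℝ}
    (ht : t ∈ Icc (tStart j) (tStart j + tHalf j)) :
    planarForce P t = ShearStage.drift 0 1 ⟨P.U j, P.U_periodic j, P.contDiff_U hδ⟩ (deriv (P.rateH j) t) := by
  funext x
  rw [planarForce_of_mem_H P ht, ShearStage.drift_apply]
  have hx : ((Torus.repr x 1 : ℝ) : UnitAddCircle) = x 1 := by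
    have h := congrFun (Torus.proj_repr x) 1
    rwa [Torus.proj_apply] at h
  rw [← hx, Torus.ShearProfile.onCircle_coe]

/-- On the V half-slot of phase `j`, `∂ₜū(t) = rateV_j′(t) U_j(x₁) e₁` is the 2D shear drift
`ShearStage.drift 1 0 ⟨U_j⟩ (rateV_j′ t)`. -/
theorem planarForce_eq_drift_of_mem_V {j : ℕ} (hδ : 0 < P.δ j) {t : ℝ}
    (ht : t ∈ Icc (tStart j + tHalf j) (tStart (j + 1))) :
    planarForce P t = ShearStage.drift 1 0 ⟨P.U j, P.U_periodic j, P.contDiff_U hδ⟩ (deriv (P.rateV j) t) := by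
  funext x
  rw [planarForce_of_mem_V P ht, ShearStage.drift_apply]
  have hx : ((Torus.repr x 0 : ℝ) : UnitAddCircle) = x 0 := by
    have h := congrFun (Torus.proj_repr x) 0
    rwa [Torus.proj_apply] at h
  rw [← hx, Torus.ShearProfile.onCircle_coe]

/-- For `t < 0` the planar force vanishes (the one-sided time derivative within `[0,1)` is taken at a point
outside the closure `[0,1]`). -/
theorem planarForce_of_neg {t : ℝ} (ht : t < 0) : planarForce P t = 0 := by
  funext y
  rw [planarForce, if_pos (ht.trans zero_lt_one)]
  show derivWithin (fun τ => P.field τ y) (Ico 0 1) t = 0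
  apply derivWithin_zero_of_notMem_closure
  rw [closure_Ico zero_ne_one]
  exact fun h => (not_le.2 ht) h.1

/-! ## Mean zero, divergence free, smooth — at every time -/

/-- **The planar force has zero mean at every time**: `∫_{𝕋²} ∂ₜū(t, x) dx = 0`. -/
theorem hasZeroMean_planarForce (hδ₀ : 0 < P.δ₀) (hd : 0 < P.d) (t : ℝ) :
    Torus.HasZeroMean (planarForce P t) := by
  rcases lt_or_ge t 0 with h0 | h0
  · rw [planarForce_of_neg P h0]
    simp [Torus.HasZeroMean]
  rcases lt_or_ge t 1 with h1 | h1
  · obtain ⟨j, hj, hj'⟩ := exists_phase h0 h1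
    have hδ := P.δ_pos hδ₀ hd j
    have hU := intervalIntegral_U_eq_zero P hδ
    rcases le_or_gt t (tStart j + tHalf j) with h | h
    · rw [planarForce_eq_drift_of_mem_H P hδ ⟨hj, h⟩]
      exact ShearStage.hasZeroMean_drift 0 1 hU _
    · rw [planarForce_eq_drift_of_mem_V P hδ ⟨h.le, hj'.le⟩]
      exact ShearStage.hasZeroMean_drift 1 0 hU _
  · rw [planarForce_of_one_le P h1]
    simp [Torus.HasZeroMean]

/-- **The planar force is divergence free at every time.** -/
theorem isDivFree_planarForce (hδ₀ : 0 < P.δ₀) (hd : 0 < P.d) (t : ℝ) :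
    Torus.IsDivFree (planarForce P t) := by
  rcases lt_or_ge t 0 with h0 | h0
  · rw [planarForce_of_neg P h0]
    exact ShearCascade.isDivFree_zero
  rcases lt_or_ge t 1 with h1 | h1
  · obtain ⟨j, hj, hj'⟩ := exists_phase h0 h1
    have hδ := P.δ_pos hδ₀ hd j
    rcases le_or_gt t (tStart j + tHalf j) with h | h
    · rw [planarForce_eq_drift_of_mem_H P hδ ⟨hj, h⟩]
      exact ShearStage.isDivFree_drift (by decide) _ _
    · rw [planarForce_eq_drift_of_mem_V P hδ ⟨h.le, hj'.le⟩]
      exact ShearStage.isDivFree_drift (by decide) _ _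
  · rw [planarForce_of_one_le P h1]
    exact ShearCascade.isDivFree_zero

/-- **The planar force is smooth at every time** (a slice of a jointly smooth field on `[0,1)`, zero elsewhere). -/
theorem isSmooth_planarForce (hδ₀ : 0 < P.δ₀) (hd : 0 < P.d) (t : ℝ) : Torus.IsSmooth (planarForce P t) := by
  rcases lt_or_ge t 0 with h0 | h0
  · rw [planarForce_of_neg P h0]
    exact Torus.isSmooth_const (0 : EuclideanSpace ℝ (Fin 2))
  rcases lt_or_ge t 1 with h1 | h1
  · exact (isSmoothSpaceTimeOn_planarForce P hδ₀ hd).isSmooth_slice ⟨h0, h1⟩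
  · rw [planarForce_of_one_le P h1]
    exact Torus.isSmooth_const (0 : EuclideanSpace ℝ (Fin 2))

end Cascade

end Summit.AnomalousDissipation.AnomalousDissipation.Theorems

end
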